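import Summits.QuantumFields.BalabanUV.Beta.EriceRemainderEnclosureHistoryAutonomyComparisonAgeCompositionLightLoad
import Summits.QuantumFields.BalabanUV.Beta.EriceRemainderEnclosureHistoryAutonomyComparisonAgeCompositionYoungestTailSumFlow
import Summits.QuantumFields.BalabanUV.Beta.EriceRemainderEnclosureHistoryAutonomyComparisonAgeCompositionThreeAgesFlowReads

/-!
# EriceRemainderEnclosureHistoryAutonomyComparisonAgeCompositionThreeAgesMassCap — (E89b) route (N), first order: THE WINDOW-LOAD CAP `x_k(m) ≤ √2∕2` of
# every age along every flow (summed domination across the age's own window, then the concavity of the levels), and THE END FROM THE UNDAMPED WINDOW LOADS: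
# for ANY profile, ANY damping in `]0,1]`, ANY horizon, the comparison surplus of every admissible excess is non-negative as soon as the TOTAL undamped window
# load `Σ_{k<K} k·L_kh_{m+k}³∕2` is at most `1` at every pin ((E86i) `flow_nonneg_of_light_total_mass` + (E82) `row_mass_le`) — the route to the three-age END
# that needs NO static family

Cell `pub-balaban`, β-function sub-cell, BINDER row D4 «RemainderConst leaves for Bałaban's split» (`HOME/BINDER-OWNERS.md`; owner lineage `b2b-balaban-beta-an4`;
this file by co-owner #2 lineage `b2b-balaban-beta-d4-p2`, generation 80), β-FLOW TEAM duty (1), FREEZE (0) honoured (def-free; imports (E86i), (E82), (E88d);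
uses (E86i) `flow_nonneg_of_light_total_mass`, (E82) `row_mass_le` ∕ `kernel_entry_le`, (E80b) `aggregate_eq_sum`, (E88d) `invSq_sub_ge_all_reads`, (E75)
`increment_anti`, (E79) `strictAnti_of_memFlow` BY NAME; nothing restated).

HONEST FRAMING (page 1, verbatim and binding).  *"Discharging BetaPertH makes Bałaban's UV stability UNCONDITIONAL — a real constructive-QFT result; it is
NOT the continuum limit and NOT the Clay problem."*  THIS FILE DISCHARGES NOTHING OF THE KIND.  Elementary real analysis about ABSTRACT functionals on a box
]0,γ]^ℕ with displayed floors, profiles and signs, and the FIRST-ORDER renewal objects of route (N) built from them — hypotheses of a census, not facts; the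
form, signs, ages and moments of Bałaban's (1.22) limit functional are NOT PRINTED ([I] p. 298; GAPS G-t4-U2-1∕-2) and NOT asserted.  Row D4 class
UNCHANGED (critical-path width 0; instance 0∕1; D4 DISCHARGE NO DATE).  HONEST DEPENDENCY: continuum YM on T⁴ ⇐ BetaPertH ∧ nine spine estimates (0/9
proved); BetaPertH ⇐ (D1) ∧ (D4) ∧ CAP+tail; G-an2-4 gates asym, D1 and NE2/3/4.

THE POINT (census sense (α); route (N); README `HOME/b2b-balaban-beta-d4-p2/g80/e89/README.md` §3–§4).  Generation 80 found (i) that the static route to the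
three-age END (the socket (E86h)∕(E87n∕p) with its families, down to (E88a)'s envelope inequality (★h°[gU])) FAILS on admissible PLATEAU flows of the light
young-saturated corner for `k₃ ≳ 40` although the END itself holds there with margin `0.44`, and (ii) that on EVERY flow of the census of generations 77–80
(affine memories of all load directions, scales, floors, `k₃ ≤ 256`; the plateau flows; an adversarial search over concave dominated level shapes with the
profile optimised EXACTLY by linear programming) the TOTAL UNDAMPED WINDOW LOAD `d_m + x₂(m) + x₃(m) = Σ_k k·L_kh_{m+k}³∕2` is at most `1∕√2 = 0.7071…`
(attained by the young age alone at `y_m = 1`, `y_{m+1} = ½`) — so the light-load END of (E86i) covers them all, for every damping `0 < g ≤ 1`, with no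
static family and no `k`-uniformity to fight for.  This file types the two elementary halves: §1 **`invSq_late_window_le`** (the `k` increments after scale
`m+k` sum to at most the `k` increments before it: `1∕h_{m+2k}² − 1∕h_{m+k}² ≤ 1∕h_{m+k}² − 1∕h_m²`), **`window_read_le_rise`** (`k·L_kh_{m+2k} ≤ 1∕h_{m+k}²
− 1∕h_m²`: domination summed across the window `[m, m+k)`), **`window_load_le`** (`k·L_kh_{m+k}³∕2 ≤ ½·(h_{m+k}∕h_{m+2k})·(1 − (h_{m+k}∕h_m)²)`),
**`window_ratio_sq_le`** (`(h_{m+k}∕h_{m+2k})² ≤ 2 − (h_{m+k}∕h_m)²`) and **`window_load_le_sqrt_two_div_two`** (`x_k(m) ≤ √2∕2`; sharper than (E82b)'s `¾`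
and SHARP); §2 **`flow_nonneg_of_window_loads_le_one`**: (E86i)'s END with its hypothesis on the aggregate DAMPED row mass replaced by `Σ_{k<K} k·L_kh_{m+k}³∕2
≤ 1` at every pin (damped ≤ undamped, (E82) `row_mass_le`), and the three loaded ages' letters **`flow_nonneg_three_ages_of_window_loads`** (`d_m + x₂(m) +
x₃(m) ≤ 1` at every pin ⟹ `0 ≤ ε ≤ e`).  NOT CLAIMED: the three-age total `d + x₂ + x₃ ≤ 1` itself (README §4: the successor's ONE target; numerically `≤ 0.755`
from the three summed-window constraints alone, `≤ 0.7071` from all of them); anything nonlinear; anything printed — NOT B12 Thm 2, NOT BetaPertH.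

WHAT IS PROVED ([folklore]; 0 `def`, 0 sorry).  §1 `invSq_late_window_le`, `window_read_le_rise`, `window_load_le`, `window_ratio_sq_le`,
`window_load_le_sqrt_two_div_two`; §2 `undamped_mass_le_window_loads`, `flow_nonneg_of_window_loads_le_one`, `flow_nonneg_three_ages_of_window_loads`.
-/
noncomputable section
open Finset

namespace Summit.QuantumFields.BalabanUV.Beta.EriceRemainderEnclosureHistoryAutonomyComparisonAgeCompositionThreeAgesMassCap

open Literature.MathematicalPhysics.QuantumFieldTheory.Balaban1983to89
open Literature.MathematicalPhysics.QuantumFieldTheory.Balaban1983to89.T4BetaStationary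
open Literature.MathematicalPhysics.QuantumFieldTheory.Balaban1983to89.T4BetaFlowWellPosed
open Summit.QuantumFields.BalabanUV.Beta.EriceRemainderEnclosureHistoryAutonomyOrder (strictAnti_of_memFlow)
open Summit.QuantumFields.BalabanUV.Beta.EriceRemainderEnclosureHistoryAutonomyComparisonAffineProfile (increment_anti)
open Summit.QuantumFields.BalabanUV.Beta.EriceRemainderEnclosureHistoryAutonomyComparisonAgeCompositionChainWiring (aggregate_eq_sum)
open Summit.QuantumFields.BalabanUV.Beta.EriceRemainderEnclosureHistoryAutonomyComparisonAgeCompositionYoungestTailSumFlow (row_mass_le kernel_entry_le)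
open Summit.QuantumFields.BalabanUV.Beta.EriceRemainderEnclosureHistoryAutonomyComparisonAgeCompositionLightLoad (flow_nonneg_of_light_total_mass)
open Summit.QuantumFields.BalabanUV.Beta.EriceRemainderEnclosureHistoryAutonomyComparisonAgeCompositionThreeAgesFlowReads (invSq_sub_ge_all_reads)

variable {B : (ℕ → ℝ) → ℝ} {γ b gIR : ℝ} {L : ℕ → ℝ} {K : ℕ} {h g : ℕ → ℝ}

/-! ## §1 The window-load cap of one age -/

/-- **THE LATE HALF OF A DOUBLE WINDOW RISES NO MORE THAN THE EARLY HALF** (isotone memory ⟹ increments non-increasing, (E75) `increment_anti`):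
`1∕h_{m+2k}² − 1∕h_{m+k}² ≤ 1∕h_{m+k}² − 1∕h_m²`. [folklore] -/
theorem invSq_late_window_le (hmono : ∀ u v : ℕ → ℝ, SeqBox γ u → SeqBox γ v → (∀ j, u j ≤ v j) → B u ≤ B v) (hb : 0 < b)
    (hlo : ∀ u, SeqBox γ u → b ≤ B u) (hh : SeqBox γ h) (hf : MemFlow B gIR h) (m k : ℕ) :
    1 / h (m + 2 * k) ^ 2 - 1 / h (m + k) ^ 2 ≤ 1 / h (m + k) ^ 2 - 1 / h m ^ 2 := by
  have hrise : ∀ n j, 1 / h (n + j) ^ 2 - 1 / h n ^ 2 = ∑ q ∈ range j, B (fun i => h (n + q + 1 + i)) := by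
    intro n j
    induction j with
    | zero => simp
    | succ j ih =>
      rw [sum_range_succ, ← ih, show n + (j + 1) = n + j + 1 by ring, hf.2 (n + j)]
      ring
  rw [show m + 2 * k = m + k + k by ring, hrise (m + k) k, hrise m k]
  exact sum_le_sum fun q _ => by
    rw [show m + k + q + 1 = (m + q + k) + 1 by ring, show m + q + 1 = (m + q) + 1 by ring]
    exact increment_anti hmono hb hlo hh hf (by omega)

/-- **DOMINATION SUMMED ACROSS THE AGE'S OWN WINDOW**: `k·L_kh_{m+2k} ≤ 1∕h_{m+k}² − 1∕h_m²` — each of the `k` increments of `[m, m+k)` reads, at age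
`k`, a level `≥ h_{m+2k}` ((E88d) `invSq_sub_ge_all_reads`, every other age dropped, `L ≥ 0`, `k < K`). [folklore] -/
theorem window_read_le_rise (hL : ∀ k, 0 ≤ L k) (hb : 0 < b) (hlo : ∀ u, SeqBox γ u → b ≤ B u)
    (hdom : ∀ u, SeqBox γ u → ∑ k ∈ range K, L k * u k ≤ B u) (hh : SeqBox γ h) (hf : MemFlow B gIR h) {k : ℕ} (hkK : k < K) (m : ℕ) :
    (k : ℝ) * (L k * h (m + 2 * k)) ≤ 1 / h (m + k) ^ 2 - 1 / h m ^ 2 := by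
  have hpos : ∀ n, 0 < h n := fun n => (hh n).1
  have hanti := (strictAnti_of_memFlow hb hlo hh hf).antitone
  have hall := invSq_sub_ge_all_reads hdom hh hf m k
  have hq : ∀ q ∈ range k, L k * h (m + 2 * k) ≤ ∑ i ∈ range K, L i * h (m + q + 1 + i) := by
    intro q hq
    have hqk := mem_range.mp hq
    have h1 : L k * h (m + 2 * k) ≤ L k * h (m + q + 1 + k) := mul_le_mul_of_nonneg_left (hanti (by omega)) (hL k)
    exact h1.trans (single_le_sum (f := fun i => L i * h (m + q + 1 + i)) (fun i _ => mul_nonneg (hL i) (hpos _).le) (mem_range.mpr hkK))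
  have hs := sum_le_sum hq
  rw [sum_const, card_range, nsmul_eq_mul] at hs
  exact hs.trans hall

/-- **THE WINDOW-LOAD CAP**: `k·L_kh_{m+k}³∕2 ≤ ½·(h_{m+k}∕h_{m+2k})·(1 − (h_{m+k}∕h_m)²)` — the window read bound times `h_{m+k}³∕(2h_{m+2k})`. [folklore] -/
theorem window_load_le (hL : ∀ k, 0 ≤ L k) (hb : 0 < b) (hlo : ∀ u, SeqBox γ u → b ≤ B u)
    (hdom : ∀ u, SeqBox γ u → ∑ k ∈ range K, L k * u k ≤ B u) (hh : SeqBox γ h) (hf : MemFlow B gIR h) {k : ℕ} (hkK : k < K) (m : ℕ) :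
    (k : ℝ) * (L k * h (m + k) ^ 3 / 2) ≤ 1 / 2 * (h (m + k) / h (m + 2 * k)) * (1 - (h (m + k) / h m) ^ 2) := by
  have hpos : ∀ n, 0 < h n := fun n => (hh n).1
  have h0 := hpos m; have h1 := hpos (m + k); have h2 := hpos (m + 2 * k)
  have hw := window_read_le_rise hL hb hlo hdom hh hf hkK m
  have hc : 0 ≤ h (m + k) ^ 3 / (2 * h (m + 2 * k)) := by positivity
  have := mul_le_mul_of_nonneg_left hw hc
  have e1 : h (m + k) ^ 3 / (2 * h (m + 2 * k)) * ((k : ℝ) * (L k * h (m + 2 * k))) = (k : ℝ) * (L k * h (m + k) ^ 3 / 2) := by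
    field_simp
  have e2 : h (m + k) ^ 3 / (2 * h (m + 2 * k)) * (1 / h (m + k) ^ 2 - 1 / h m ^ 2) = 1 / 2 * (h (m + k) / h (m + 2 * k)) * (1 - (h (m + k) / h m) ^ 2) := by
    rw [div_pow]; field_simp
  rw [e1, e2] at this
  exact this

/-- The level ratio across the late half of the double window: `(h_{m+k}∕h_{m+2k})² ≤ 2 − (h_{m+k}∕h_m)²` (§1 `invSq_late_window_le` divided by `1∕h_{m+k}²`).
[folklore] -/
theorem window_ratio_sq_le (hmono : ∀ u v : ℕ → ℝ, SeqBox γ u → SeqBox γ v → (∀ j, u j ≤ v j) → B u ≤ B v) (hb : 0 < b)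
    (hlo : ∀ u, SeqBox γ u → b ≤ B u) (hh : SeqBox γ h) (hf : MemFlow B gIR h) (m k : ℕ) :
    (h (m + k) / h (m + 2 * k)) ^ 2 ≤ 2 - (h (m + k) / h m) ^ 2 := by
  have hpos : ∀ n, 0 < h n := fun n => (hh n).1
  have h0 := hpos m; have h1 := hpos (m + k); have h2 := hpos (m + 2 * k)
  have hw := invSq_late_window_le hmono hb hlo hh hf m k
  have := mul_le_mul_of_nonneg_left hw (le_of_lt (pow_pos h1 2))
  have e1 : h (m + k) ^ 2 * (1 / h (m + 2 * k) ^ 2 - 1 / h (m + k) ^ 2) = (h (m + k) / h (m + 2 * k)) ^ 2 - 1 := by rw [div_pow]; field_simp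
  have e2 : h (m + k) ^ 2 * (1 / h (m + k) ^ 2 - 1 / h m ^ 2) = 1 - (h (m + k) / h m) ^ 2 := by rw [div_pow]; field_simp
  rw [e1, e2] at this
  linarith

/-- **`x_k(m) ≤ √2∕2` ALONG EVERY FLOW** (isotone dominated memory with floor, any pin, any age `k < K`): the window-load cap with the level ratio at most `√2`
and the factor `1 − (h_{m+k}∕h_m)² ≤ 1`.  SHARP: the young age on a flow with `a_m → 0`, `a_{m+2} = 2a_{m+1}` has `d_m → √2∕2`; (E82b)'s cap was `¾`. [folklore] -/
theorem window_load_le_sqrt_two_div_two (hmono : ∀ u v : ℕ → ℝ, SeqBox γ u → SeqBox γ v → (∀ j, u j ≤ v j) → B u ≤ B v)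
    (hL : ∀ k, 0 ≤ L k) (hb : 0 < b) (hlo : ∀ u, SeqBox γ u → b ≤ B u) (hdom : ∀ u, SeqBox γ u → ∑ k ∈ range K, L k * u k ≤ B u)
    (hh : SeqBox γ h) (hf : MemFlow B gIR h) {k : ℕ} (hkK : k < K) (m : ℕ) :
    (k : ℝ) * (L k * h (m + k) ^ 3 / 2) ≤ Real.sqrt 2 / 2 := by
  have hpos : ∀ n, 0 < h n := fun n => (hh n).1
  have h0 := hpos m; have h1 := hpos (m + k); have h2 := hpos (m + 2 * k)
  have hcap := window_load_le hL hb hlo hdom hh hf hkK m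
  have hrat := window_ratio_sq_le hmono hb hlo hh hf m k
  set t : ℝ := h (m + k) / h (m + 2 * k) with ht
  set s : ℝ := (h (m + k) / h m) ^ 2 with hs
  have ht0 : 0 ≤ t := le_of_lt (div_pos h1 h2)
  have hs0 : 0 ≤ s := sq_nonneg _
  have ht2 : t ^ 2 ≤ 2 := by linarith
  have htle : t ≤ Real.sqrt 2 := by
    rw [← Real.sqrt_sq ht0]; exact Real.sqrt_le_sqrt ht2
  calc (k : ℝ) * (L k * h (m + k) ^ 3 / 2) ≤ 1 / 2 * t * (1 - s) := hcap
    _ ≤ 1 / 2 * t * 1 := mul_le_mul_of_nonneg_left (by linarith) (by positivity)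
    _ ≤ Real.sqrt 2 / 2 := by linarith

/-! ## §2 The END from the undamped window loads -/

/-- **DAMPED ≤ UNDAMPED**: the aggregate damped row mass of the whole profile is at most the total undamped window load,
`Σ_{l<K} KA 1 m l ≤ Σ_{k<K} k·L_kh_{m+k}³∕2` (`KA 1 = Σ_{1≤k<K} KL k` by (E80b) `aggregate_eq_sum`; each age by (E82) `row_mass_le`). [folklore] -/
theorem undamped_mass_le_window_loads (hL : ∀ k, 0 ≤ L k) (hh : SeqBox γ h) (hg : ∀ t, 0 < g t ∧ g t ≤ 1) (hK : 1 ≤ K)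
    {KL : ℕ → ℕ → ℕ → ℝ}
    (hKL : ∀ k n l, KL k n l = if 0 < k ∧ k < K ∧ l < k then L k * h (n + k) ^ 3 / 2 * ∏ t ∈ Ico (n + 1 + l) (n + k + 1), g t else 0)
    {KA : ℕ → ℕ → ℕ → ℝ} (hKA : ∀ i m l, KA i m l = KL i m l + KA (i + 1) m l) (hKAtop : ∀ m l, KA K m l = 0) (m : ℕ) :
    ∑ l ∈ range K, KA 1 m l ≤ ∑ k ∈ range K, (k : ℝ) * (L k * h (m + k) ^ 3 / 2) := by
  have hpos : ∀ n, 0 < h n := fun n => (hh n).1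
  have hKA1 : ∀ l, KA 1 m l = ∑ k ∈ Ico 1 (K - 1 + 1), KL k m l := fun l =>
    aggregate_eq_sum (n := K - 1) hKA (fun m l => by rw [Nat.sub_add_cancel hK]; exact hKAtop m l) (show 1 ≤ K - 1 + 1 by omega) m l
  have hK1 : K - 1 + 1 = K := Nat.sub_add_cancel hK
  calc ∑ l ∈ range K, KA 1 m l = ∑ l ∈ range K, ∑ k ∈ Ico 1 K, KL k m l := sum_congr rfl fun l _ => by rw [hKA1, hK1]
    _ = ∑ k ∈ Ico 1 K, ∑ l ∈ range K, KL k m l := sum_comm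
    _ ≤ ∑ k ∈ Ico 1 K, (k : ℝ) * (L k * h (m + k) ^ 3 / 2) :=
        sum_le_sum fun k hk => row_mass_le hL hh hg hKL (mem_Ico.mp hk).2 m
    _ ≤ ∑ k ∈ range K, (k : ℝ) * (L k * h (m + k) ^ 3 / 2) :=
        sum_le_sum_of_subset_of_nonneg (fun k hk => by rw [mem_range]; exact (mem_Ico.mp hk).2) fun k _ _ => by
          have := hL k; have := hpos (m + k); positivity

/-- **ROUTE (N), FIRST ORDER — THE END FROM THE UNDAMPED WINDOW LOADS (ANY PROFILE, ANY DAMPING, ANY HORIZON).**  `L ≥ 0` on the ages `< K` (`K ≥ 1`),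
`h` a box history, `g` a damping with `0 < g ≤ 1`, the lone kernels `KL` and their aggregates `KA` as displayed, horizon `N ≥ K`.  IF the total undamped window
load satisfies `Σ_{k<K} k·L_kh_{m+k}³∕2 ≤ 1` at every pin `m`, THEN the comparison surplus `ε` of every admissible excess `e` (`e ≥ 0` non-increasing, `e_m = 0`
for `m > N`) satisfies `0 ≤ ε m ≤ e m` at every pin ((E86i) `flow_nonneg_of_light_total_mass` with §2 `undamped_mass_le_window_loads`). [folklore] -/
theorem flow_nonneg_of_window_loads_le_one (hL : ∀ k, 0 ≤ L k) (hh : SeqBox γ h) (hg : ∀ t, 0 < g t ∧ g t ≤ 1) (hK : 1 ≤ K) {N : ℕ} (hKN : K ≤ N)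
    {KL : ℕ → ℕ → ℕ → ℝ}
    (hKL : ∀ k n l, KL k n l = if 0 < k ∧ k < K ∧ l < k then L k * h (n + k) ^ 3 / 2 * ∏ t ∈ Ico (n + 1 + l) (n + k + 1), g t else 0)
    {KA : ℕ → ℕ → ℕ → ℝ} {RA : ℕ → (ℕ → ℝ) → ℕ → ℝ}
    (hRA : ∀ i v m, RA i v m = ∑ l ∈ range K, KA i m l * v (m + 1 + l))
    (hKA : ∀ i m l, KA i m l = KL i m l + KA (i + 1) m l) (hKAtop : ∀ m l, KA K m l = 0)
    (hx : ∀ m, ∑ k ∈ range K, (k : ℝ) * (L k * h (m + k) ^ 3 / 2) ≤ 1)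
    {e ε : ℕ → ℝ} (he0 : ∀ m, 0 ≤ e m) (hea : ∀ m, e (m + 1) ≤ e m)
    (hεt : ∀ m, N < m → ε m = 0) (hεrec : ∀ m, ε m = e m - RA 1 ε m) : ∀ m, 0 ≤ ε m ∧ ε m ≤ e m :=
  flow_nonneg_of_light_total_mass hL hh hg hK hKN hKL hRA hKA hKAtop
    (fun m => (undamped_mass_le_window_loads hL hh hg hK hKL hKA hKAtop m).trans (hx m)) he0 hea hεt hεrec

/-- **THE THREE LOADED AGES** (`1 < k₂ < k₃ < K`, `L_j = 0` for every other age `j < K`): in the census letters `d_m = L_1h_{m+1}³∕2`, `x₂(m) =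
k₂·L_{k₂}h_{m+k₂}³∕2`, `x₃(m) = k₃·L_{k₃}h_{m+k₃}³∕2` — IF `d_m + x₂(m) + x₃(m) ≤ 1` at every pin THEN `0 ≤ ε ≤ e` for every admissible excess, every
damping `0 < g ≤ 1`, every horizon `N ≥ K`.  (Each of the three is `≤ √2∕2` along every flow by §1; the census of README §3 has the SUM `≤ 0.7071`
everywhere; its proof along flows is the successor's target.) [folklore] -/
theorem flow_nonneg_three_ages_of_window_loads (hL : ∀ k, 0 ≤ L k) (hh : SeqBox γ h) (hg : ∀ t, 0 < g t ∧ g t ≤ 1)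
    {k₂ k₃ : ℕ} (hk2 : 2 ≤ k₂) (hk23 : k₂ < k₃) (hk3K : k₃ < K) (hL3 : ∀ j, j < K → j ≠ 1 → j ≠ k₂ → j ≠ k₃ → L j = 0) {N : ℕ} (hKN : K ≤ N)
    {KL : ℕ → ℕ → ℕ → ℝ}
    (hKL : ∀ k n l, KL k n l = if 0 < k ∧ k < K ∧ l < k then L k * h (n + k) ^ 3 / 2 * ∏ t ∈ Ico (n + 1 + l) (n + k + 1), g t else 0)
    {KA : ℕ → ℕ → ℕ → ℝ} {RA : ℕ → (ℕ → ℝ) → ℕ → ℝ}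
    (hRA : ∀ i v m, RA i v m = ∑ l ∈ range K, KA i m l * v (m + 1 + l))
    (hKA : ∀ i m l, KA i m l = KL i m l + KA (i + 1) m l) (hKAtop : ∀ m l, KA K m l = 0)
    {d x₂ x₃ : ℕ → ℝ} (hd : ∀ m, d m = L 1 * h (m + 1) ^ 3 / 2) (hx2 : ∀ m, x₂ m = (k₂ : ℝ) * (L k₂ * h (m + k₂) ^ 3 / 2))
    (hx3 : ∀ m, x₃ m = (k₃ : ℝ) * (L k₃ * h (m + k₃) ^ 3 / 2)) (htot : ∀ m, d m + x₂ m + x₃ m ≤ 1)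
    {e ε : ℕ → ℝ} (he0 : ∀ m, 0 ≤ e m) (hea : ∀ m, e (m + 1) ≤ e m)
    (hεt : ∀ m, N < m → ε m = 0) (hεrec : ∀ m, ε m = e m - RA 1 ε m) : ∀ m, 0 ≤ ε m ∧ ε m ≤ e m := by
  have hK : 1 ≤ K := by omega
  refine flow_nonneg_of_window_loads_le_one hL hh hg hK hKN hKL hRA hKA hKAtop (fun m => ?_) he0 hea hεt hεrec
  have hsub : ({1, k₂, k₃} : Finset ℕ) ⊆ range K := by
    intro j hj
    simp only [mem_insert, mem_singleton] at hj
    rw [mem_range]; rcases hj with rfl | rfl | rfl <;> omega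
  rw [← sum_subset hsub (fun j hj hjn => by
    simp only [mem_insert, mem_singleton, not_or] at hjn
    rw [hL3 j (mem_range.mp hj) hjn.1 hjn.2.1 hjn.2.2, zero_mul, zero_div, mul_zero])]
  rw [sum_insert (by simp only [mem_insert, mem_singleton]; omega), sum_pair (by omega), Nat.cast_one, one_mul]
  have := htot m
  rw [hd, hx2, hx3] at this
  linarith

end Summit.QuantumFields.BalabanUV.Beta.EriceRemainderEnclosureHistoryAutonomyComparisonAgeCompositionThreeAgesMassCap

end
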